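/-
[OURS · L1 W4.5(b) · EL♮(3)] SPECIMEN-Q DOWNSTAIRS — part T (one TC step through a chart).
[claim: Hironaka2017, status: under-review]
-/
import Summits.ResolutionOfSingularities.ResolutionOfSingularities.Theorems.EquisingularLiftEquisingularLiftNatSpecimenQuarticTcDeltaEngineClauses
import Summits.ResolutionOfSingularities.ResolutionOfSingularities.Theorems.EquisingularLiftEquisingularLiftNatSpecimenQuarticTcDeltaAmbientCharts

/-!
# [OURS · L1 W4.5(b) · EL♮(3)] SPECIMEN-Q DOWNSTAIRS, part T — ONE (TC) STEP THROUGH A CHART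
# (crux `EquisingularLiftNatThree` = stmt-ResolutionOfSingularities-20148, line `sections3`; res-L1-w45b-lead-2 CUT 2026-08-27T08:41:07Z
# «SPECIMEN-Q DOWNSTAIRS» to res-D-pv-034 AS res-L1-s36-pv-3; helper, closes nothing)

HONEST FRAMING. OURS (cell `res-hironaka`, chain w45b, slot W4.5(b)); NOT a statement of any manuscript; AI-written, weaker than
expert review.

Setting: an ambient scheme `Y`, an open-immersion chart `u : Spec k[X₀,X₁,X₂] → Y`, a closed point `x₀ = u(𝔪₀-point)` with
`𝓘_{x₀} · 𝒪 = 𝔪₀~` on the chart, and a closed set `T ⊆ Y` with `𝓘_T · 𝒪 = (z² + x⁴ + y⁴)~` on the chart (these are exactly the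
data `…TcDeltaStage` provides for the quartic `V(x₀²x₃² + x₁⁴ + x₂⁴) ⊂ ℙ³` at each singular point, and which survive transport along
an isomorphism over a neighbourhood of the point). For ANY blow-up `b : Y′ → Y` of `Y` at `x₀` (`IsBlowup b 𝓘_{x₀}`) this file proves
the inputs of the (TC) constructor of the registered stub `stub_elnat_tcDeltaPointResolution` that concern `Y′`:

* `not_exc_subset_strict` : `¬ (b⁻¹{x₀} ⊆ closure (b⁻¹(T ∖ {x₀})))` («e ⊄ T₂»);
* `not_strict_subset_inter` : `¬ (closure (b⁻¹(T ∖ {x₀})) ⊆ b⁻¹{x₀} ∩ closure (b⁻¹(T ∖ {x₀})))` («T₂ ⊄ supp 𝓘_{Z₁}»);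
* `isClosed_inter` : `Z₁ = b⁻¹{x₀} ∩ closure (b⁻¹(T ∖ {x₀}))` is closed;
* `isRegular_inter` / `finite_nonregular_inter` : `V(Z₁)_red` is regular, so its non-regular locus is finite («Sing finite»);
* `isPrincipal_ideal_chartOpen` : `𝓘_{closure T}(U)` is principal on the affine open `U = u(Spec k[X])` ∋ `x₀` («R1(b)» input).

Mechanism: the engine (`…TcDeltaEngine`, `…TcDeltaEngineClauses`) instantiated at `U := chartOpen u`, `e := chartRingEquiv u`, fed with
the chart computations of `…TcDeltaAmbientCharts` (C1)–(C4): on the `z`-chart `(z/1, f′) = (1)`; on the `x`- and `y`-charts `f′` is prime,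
does not divide the exceptional generator, `√(exc, f′) = (exc, z/·)` with regular quotient.

References: Hartshorne II Prop. 7.16, Ex. 3.2.6; Stacks 0804, 052Q, 080E (via the cited tree files).
-/

set_option linter.dupNamespace false -- mandated namespace `Summit.<Summit>.<Problem>` of this single-conjunct summit

noncomputable section

open CategoryTheory CategoryTheory.Limits AlgebraicGeometry TopologicalSpace
open MvPolynomial
open AlgebraicGeometry.Scheme.IdealSheafData
open Literature.AlgebraicGeometry.Resolution
open Summit.ResolutionOfSingularities.ResolutionOfSingularities.Theorems.EquisingularLift

namespace Summit.ResolutionOfSingularities.ResolutionOfSingularities.Cruxes.EquisingularLiftNat.Sections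

namespace SpecimenQuarticTcDelta

section ChartStep

variable {k : Type} [Field k]
variable {Y : Scheme.{0}} (u : Spec (CommRingCat.of (MvPolynomial (Fin 3) k)) ⟶ Y) [IsOpenImmersion u]
variable {x₀ : Y} (hx₀ : IsClosed ({x₀} : Set Y))
variable (hux : (vanishingIdeal (⟨{x₀}, hx₀⟩ : Closeds Y)).comap u =
    ofIdealTop ((PointBlowup.originIdeal 2 k).map (Scheme.ΓSpecIso (CommRingCat.of (MvPolynomial (Fin 3) k))).inv.hom))
variable {T : Set Y} (hTc : IsClosed T)
variable (huT : (vanishingIdeal (⟨T, hTc⟩ : Closeds Y)).comap u =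
    ofIdealTop ((Ideal.span {(X 2 ^ 2 + X 0 ^ 4 + X 1 ^ 4 : MvPolynomial (Fin 3) k)}).map
      (Scheme.ΓSpecIso (CommRingCat.of (MvPolynomial (Fin 3) k))).inv.hom))

/-! ## The engine data `(U, e, hI, hT)` of the chart -/

include hux in
/-- `hI`: the ideal of `x₀` on `U = u(Spec k[X])` corresponds to `𝔪₀`. [folklore] -/
theorem hI_chart : ((vanishingIdeal (⟨{x₀}, hx₀⟩ : Closeds Y)).ideal (chartOpen u)).map (chartRingEquiv u).toRingHom =
    PointBlowup.originIdeal 2 k :=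
  map_ideal_chartOpen_eq u _ _ hux

include huT in
/-- `hTI`: the ideal of `T` on `U` is generated by `e⁻¹(z² + x⁴ + y⁴)`. [folklore] -/
theorem hTI_chart : (vanishingIdeal (⟨T, hTc⟩ : Closeds Y)).ideal (chartOpen u) =
    Ideal.span {(chartRingEquiv u).symm (X 2 ^ 2 + X 0 ^ 4 + X 1 ^ 4)} :=
  ideal_chartOpen_eq_span u _ _ huT

include huT in
/-- `hT`: membership in `T` over `U` is vanishing of `e⁻¹(z² + x⁴ + y⁴)`. [folklore] -/
theorem hT_chart (r : Spec Γ(Y, (chartOpen u : Y.Opens))) :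
    (chartOpen u).2.fromSpec r ∈ T ↔ (chartRingEquiv u).symm (X 2 ^ 2 + X 0 ^ 4 + X 1 ^ 4) ∈ r.asIdeal :=
  fromSpec_mem_iff_of_ideal_eq hTc (hTI_chart u hTc huT) r

include huT in
/-- **(R1(b) input)** `𝓘_{closure T}(U)` is principal on the affine open `U = u(Spec k[X])`. [folklore] -/
theorem isPrincipal_ideal_chartOpen :
    ((vanishingIdeal (⟨closure T, isClosed_closure⟩ : Closeds Y)).ideal (chartOpen u)).IsPrincipal := by
  have hcl : (⟨closure T, isClosed_closure⟩ : Closeds Y) = ⟨T, hTc⟩ := Closeds.ext hTc.closure_eq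
  rw [hcl, hTI_chart u hTc huT]
  exact ⟨⟨_, rfl⟩⟩

/-! ## The (TC) clauses for a blow-up `b : Y′ → Y` at `x₀` -/

variable {Y' : Scheme.{0}} {b : Y' ⟶ Y}

include hx₀ in
/-- `Z₁ = b⁻¹{x₀} ∩ closure (b⁻¹(T ∖ {x₀}))` is closed. [folklore] -/
theorem isClosed_inter (b : Y' ⟶ Y) : IsClosed (b ⁻¹' {x₀} ∩ closure (b ⁻¹' (T \ {x₀}))) :=
  (hx₀.preimage b.continuous).inter isClosed_closure

include hux huT in
/-- **«e ⊄ T₂»**: the exceptional divisor is not contained in the strict transform (seen on the `z`-chart, where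
`(z/1, f′₂) = (1)`). [OURS · (TC) input] [folklore] -/
theorem not_exc_subset_strict (hb : IsBlowup b (vanishingIdeal (⟨{x₀}, hx₀⟩ : Closeds Y))) :
    ¬ (b ⁻¹' {x₀} ⊆ closure (b ⁻¹' (T \ {x₀}))) := by
  obtain ⟨c, hc, -, hcb⟩ := exists_chartE (chartOpen u) (chartRingEquiv u) hx₀ (hI_chart u hx₀ hux) hb 2
  exact not_preimage_singleton_subset_strictTransform hx₀ (hI_chart u hx₀ hux) (hT_chart u hTc huT) hcb (factor_chart₂ k)
    (span_exc_strict_chart₂_eq_top k)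

include hux huT in
/-- **«T₂ ⊄ supp 𝓘_{Z₁}»**: the strict transform is not contained in `Z₁` (seen on the `x`-chart, where `f′₀` is prime and does not
divide `x/1`). Needs `k = k̄`, `char k ≠ 2` (primality of `f′₀`). [OURS · (TC) input] [folklore] -/
theorem not_strict_subset_inter [IsAlgClosed k] (h2 : (2 : k) ≠ 0)
    (hb : IsBlowup b (vanishingIdeal (⟨{x₀}, hx₀⟩ : Closeds Y))) :
    ¬ (closure (b ⁻¹' (T \ {x₀})) ⊆ b ⁻¹' {x₀} ∩ closure (b ⁻¹' (T \ {x₀}))) := by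
  obtain ⟨c, hc, -, hcb⟩ := exists_chartE (chartOpen u) (chartRingEquiv u) hx₀ (hI_chart u hx₀ hux) hb 0
  exact not_strictTransform_subset_inter hx₀ (hI_chart u hx₀ hux) (hT_chart u hTc huT) hcb (factor_chart₀ k)
    (prime_strict_chart₀ k h2) (not_strict_dvd_exc_chart₀ k)

include hux huT in
/-- **`V(Z₁)_red` is regular** (`Z₁ = b⁻¹{x₀} ∩ closure (b⁻¹(T ∖ {x₀}))`): every point of `Z₁` lies over `U`, hence in one of the three
charts; the `z`-chart carries no point of `Z₁`; on the `x`/`y`-charts `√(exc, f′) = (exc, z/·)` has the regular quotient `k[s,t]`.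
[OURS · (TC) input «Sing V(Z₁)_red finite»] [cite: Hartshorne1977, II Example 3.2.6] -/
theorem isRegular_inter [IsAlgClosed k] (h2 : (2 : k) ≠ 0) (hx₀u : x₀ ∈ Set.range u)
    (hb : IsBlowup b (vanishingIdeal (⟨{x₀}, hx₀⟩ : Closeds Y))) :
    Scheme.IsRegular (vanishingIdeal (⟨b ⁻¹' {x₀} ∩ closure (b ⁻¹' (T \ {x₀})), isClosed_inter hx₀ b⟩ : Closeds Y')).subscheme := by
  have hI := hI_chart u hx₀ hux
  have hT := hT_chart u hTc huT
  choose c hc hco hcb using fun i => exists_chartE (chartOpen u) (chartRingEquiv u) hx₀ hI hb i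
  haveI : ∀ i, IsOpenImmersion (c i) := hc
  have H : ∀ (i : Fin 3)
      (z : (vanishingIdeal (⟨b ⁻¹' {x₀} ∩ closure (b ⁻¹' (T \ {x₀})), isClosed_inter hx₀ b⟩ : Closeds Y')).subscheme),
      (vanishingIdeal (⟨b ⁻¹' {x₀} ∩ closure (b ⁻¹' (T \ {x₀})), isClosed_inter hx₀ b⟩ : Closeds Y')).subschemeι z ∈
          b ⁻¹' {x₀} ∩ closure (b ⁻¹' (T \ {x₀})) →
        (vanishingIdeal (⟨b ⁻¹' {x₀} ∩ closure (b ⁻¹' (T \ {x₀})), isClosed_inter hx₀ b⟩ : Closeds Y')).subschemeι z ∈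
          Set.range (c i) →
        IsRegularLocalRing ((vanishingIdeal (⟨b ⁻¹' {x₀} ∩ closure (b ⁻¹' (T \ {x₀})), isClosed_inter hx₀ b⟩ :
          Closeds Y')).subscheme.presheaf.stalk z) := by
    intro i
    fin_cases i <;> intro z hzZ hi
    · haveI := isRegularRing_quotient_exc_frac_chart₀ k
      exact isRegularLocalRing_inter_of_mem_range_chart hx₀ hI hT (hcb 0) (factor_chart₀ k) (prime_strict_chart₀ k h2)
        (not_strict_dvd_exc_chart₀ k) _ (radical_span_exc_strict_chart₀ k) (isClosed_inter hx₀ b) z hi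
    · haveI := isRegularRing_quotient_exc_frac_chart₁ k
      exact isRegularLocalRing_inter_of_mem_range_chart hx₀ hI hT (hcb 1) (factor_chart₁ k) (prime_strict_chart₁ k h2)
        (not_strict_dvd_exc_chart₁ k) _ (radical_span_exc_strict_chart₁ k) (isClosed_inter hx₀ b) z hi
    · exact absurd hzZ (not_mem_inter_of_mem_range_chart_of_top hx₀ hI hT (hcb 2) (factor_chart₂ k)
        (span_exc_strict_chart₂_eq_top k) hi)
  intro z
  have hzZ : (vanishingIdeal (⟨b ⁻¹' {x₀} ∩ closure (b ⁻¹' (T \ {x₀})), isClosed_inter hx₀ b⟩ : Closeds Y')).subschemeι z ∈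
      b ⁻¹' {x₀} ∩ closure (b ⁻¹' (T \ {x₀})) := by
    have h := Set.mem_range_self
      (f := fun t => (vanishingIdeal (⟨b ⁻¹' {x₀} ∩ closure (b ⁻¹' (T \ {x₀})), isClosed_inter hx₀ b⟩ : Closeds Y')).subschemeι t) z
    rw [range_subschemeι, Scheme.IdealSheafData.coe_support_vanishingIdeal] at h
    exact h
  have hy : b ((vanishingIdeal (⟨b ⁻¹' {x₀} ∩ closure (b ⁻¹' (T \ {x₀})), isClosed_inter hx₀ b⟩ : Closeds Y')).subschemeι z) ∈
      (chartOpen u : Y.Opens) := by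
    rw [show b ((vanishingIdeal (⟨b ⁻¹' {x₀} ∩ closure (b ⁻¹' (T \ {x₀})), isClosed_inter hx₀ b⟩ :
      Closeds Y')).subschemeι z) = x₀ from hzZ.1]
    exact mem_chartOpen_of_mem_range u hx₀u
  obtain ⟨i, hi⟩ := exists_mem_range_chart hx₀ hI hb c hco hy
  exact H i z hzZ hi

include hux huT in
/-- **«Sing V(Z₁)_red finite»** — in fact empty. [OURS · (TC) input] [folklore] -/
theorem finite_nonregular_inter [IsAlgClosed k] (h2 : (2 : k) ≠ 0) (hx₀u : x₀ ∈ Set.range u)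
    (hb : IsBlowup b (vanishingIdeal (⟨{x₀}, hx₀⟩ : Closeds Y))) :
    Set.Finite {z : (vanishingIdeal (⟨b ⁻¹' {x₀} ∩ closure (b ⁻¹' (T \ {x₀})), isClosed_inter hx₀ b⟩ : Closeds Y')).subscheme |
      ¬ IsRegularLocalRing ((vanishingIdeal (⟨b ⁻¹' {x₀} ∩ closure (b ⁻¹' (T \ {x₀})), isClosed_inter hx₀ b⟩ :
        Closeds Y')).subscheme.presheaf.stalk z)} := by
  have hreg := isRegular_inter u hx₀ hux hTc huT h2 hx₀u hb
  have hempty : {z : (vanishingIdeal (⟨b ⁻¹' {x₀} ∩ closure (b ⁻¹' (T \ {x₀})), isClosed_inter hx₀ b⟩ : Closeds Y')).subscheme |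
      ¬ IsRegularLocalRing ((vanishingIdeal (⟨b ⁻¹' {x₀} ∩ closure (b ⁻¹' (T \ {x₀})), isClosed_inter hx₀ b⟩ :
        Closeds Y')).subscheme.presheaf.stalk z)} = ∅ := by
    ext z
    simp only [Set.mem_setOf_eq, Set.mem_empty_iff_false, iff_false, not_not]
    exact hreg z
  rw [hempty]
  exact Set.finite_empty

end ChartStep

end SpecimenQuarticTcDelta

end Summit.ResolutionOfSingularities.ResolutionOfSingularities.Cruxes.EquisingularLiftNat.Sections
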